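import Literature.NumberTheory.GaloisRepresentations.IdeleLocalInvariantsCanonical
import Literature.NumberTheory.GaloisRepresentations.GaloisCohomologyLayerInflationTransitive
import HarnessLib

/-!
# `inv_{L'/K} ∘ Inf = inv_{L/K}` for the cochain-level inflation of an abstract tower `K ⊆ L ⊆ L'` of finite Galois
# layers (Serre, *Local Fields* XI §2–§3 — `inv_E` on the union of the `H²(F/E)` along the injective inflations; XIII §3
# Prop. 7 / Cor. 2 for the local `inv_K`; Serre, C–F VI §1.6)

Topic `NumberTheory/GaloisRepresentations`; namespace `Literature.NumberTheory.GaloisRepresentations.UnitsLayer`, continuing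
`LocalCanonicalFundamentalClassAbstract.lean` (door-c6 g10: `layerInv K L`, THE invariant of an abstract layer, through the
embedded copy `embeddedField K L ⊆ K̄`; `unitsCohomologyIso`), `LocalCanonicalFundamentalClassTower.lean` (the inflation READ
INSIDE `Br(K)` — "not here: the identification with the engine's cochain-level `Inf`"), `GaloisCohomologyLayerInflationTransitive`
(door-c6 g10: `layerInf`, **`infTwo_layerInf`** for embedded layers `E ≤ E'`) and `IdeleLocalInvariantsCanonical.lean`
(door-c5: `unitsInfTwo_unitsCohomologyIso_eq_of_eq`, transport-invariance).  Definitions with bodies (`unitsPairHom`,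
`unitsPairInf`) and theorems; NO named fact, no `sorry`, no instance, no notation.

Mathematics.  A COMPATIBLE PAIR for finite Galois layers `L, L'` of `K` is `i : L →ₐ[K] L'` together with
`r : Gal(L'/K) → Gal(L/K)` such that `i (r ψ' x) = ψ' (i x)` (restriction of automorphisms along `i`); it is a morphism of
pairs `(Gal(L'/K), L'ˣ) → (Gal(L/K), Lˣ)` and induces the cochain-level inflation `Inf = H²(r, i) : H²(Gal(L/K), Lˣ) →
H²(Gal(L'/K), L'ˣ)` (Mathlib `groupCohomology.map`).  THEOREM (`layerInv_unitsPairInf`): for a char-0 non-archimedean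
local field `K`, **`inv_{L'/K} (Inf x) = inv_{L/K} (x)`** (Serre XI §2: in a class formation `inv_E` is defined on `H²(·/E) = ⋃ H²(F/E)`,
the union along the injective inflations — so `inv` is compatible with `Inf` by construction; XI §3: `Inf(u_{F/E}) =
[F':F]·u_{F'/E}`).  Proof:
inside `K̄` the images `L₁ = φ(L) ≤ L₀' = φ'(L')` (`φ' : L' → K̄` the chosen embedding, `φ = φ' ∘ i`) are embedded layers;
the square "`Inf` then transport to `L₀'`" = "transport to `L₁` then door-c6's `layerInf`" holds at the level of
morphisms of pairs into `(Γ_K ⧸ Γ_{L₀'}, (K̄ˣ)^{Γ_{L₀'}})` (`map_comp`/`map_congr'`), `infTwo_layerInf` removes `layerInf`,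
and the transport to `L₁` computes `layerInv K L` by transport-invariance (`L₁ = embeddedField K L` by normality).

## What is formalised

* §1 `unitsPairHom`, `unitsPairInf` (the cochain-level `Inf` of a compatible pair), `fieldRange_eq_embeddedField`
  (any `K`-embedding of `L` into `K̄` has image `embeddedField K L`), `unitsInfTwo_eq_infTwo`.
* §2 `unitsPairInf_transport_eq_layerInf` (the square of pair morphisms), **`layerInv_unitsPairInf`**.

## References
* J.-P. Serre, *Local Fields*, GTM 67 (1979), Ch. XI §2–§3 (class formations: `inv_E` on the union along `Inf`,
  `Inf(u_{F/E}) = [F':F]·u_{F'/E}`), Ch. XIII §3 Prop. 7 and Cor. 2 (the local `inv_K`, its range on `H²(L/K)`),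
  Ch. X §4 Prop. 6. [SerreLocalFields1979]
* J.-P. Serre, *Galois Cohomology* (1997), Ch. I §2.2 Prop. 8 (compatibility of inflations). [SerreGaloisCohomology1997]
-/

-- CITATION-FIX (2026-08-27, door-c5 g15; referee Q-g51-2 locus 3 + N-g51-4; held copy `book:serre1979-local-fields`):
-- earlier revisions cited "Serre XIII §3 Prop. 7 Cor. 1" for `inv ∘ Inf = inv` — Cor. 1 [held p0170] is the splitting
-- criterion (`a` split by `L` iff `na = 0`) and XIII §3 has no `Inf` statement; the compatibility with inflation is the
-- class-formation formalism of XI §2 [held p0149: for `q = 2` the inflations are injective and `H²(·/E)` is their union, on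
-- which `inv_E` is defined] and XI §3 [held p0150: `Inf(u_{F/E}) = [F':F]·u_{F'/E}`].  Also "Tate, C–F VI §1.6" named the
-- wrong author: Ch. VI of Cassels–Fröhlich (local class field theory) is Serre's.  Declarations unchanged.

noncomputable section

open CategoryTheory groupCohomology Function

namespace Literature.NumberTheory.GaloisRepresentations

namespace UnitsLayer

open Literature.Algebra.Homology LocalWeilDatum DiscreteGaloisModule
open Literature.AnabelianGeometry.AbsoluteAnabelian.Prop121vii

/-! ## §1. The cochain-level inflation of a compatible pair -/

section Pair

variable (K : Type) [Field K] {L L' : Type} [Field L] [Field L'] [Algebra K L] [Algebra K L']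

/-- **`Lˣ → L'ˣ` as a morphism of pairs `Res_r(Lˣ) ⟶ L'ˣ`** for a compatible pair `(r, i)`: `i (r ψ' x) = ψ' (i x)`.
[cite: SerreLocalFields1979, Ch. XI §3] -/
def unitsPairHom (i : L →ₐ[K] L') (r : (L' ≃ₐ[K] L') →* (L ≃ₐ[K] L)) (hri : ∀ ψ' x, i (r ψ' x) = ψ' (i x)) :
    Rep.res r (Rep.ofAlgebraAutOnUnits K L) ⟶ Rep.ofAlgebraAutOnUnits K L' :=
  Rep.ofHom (LinearMap.intertwiningMap_of_isIntertwiningMap _ _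
    (MonoidHom.toAdditive (Units.map (i : L →* L'))).toIntLinearMap fun ψ' x => by
      apply (Additive.toMul (α := L'ˣ)).injective
      refine Units.ext ?_
      change i (((r ψ') • (Additive.toMul x : Lˣ) : Lˣ) : L) = ((ψ' • Units.map (i : L →* L') (Additive.toMul x) : L'ˣ) : L')
      rw [AlgEquiv.smul_units_def, AlgEquiv.smul_units_def, Units.coe_map, Units.coe_map, Units.coe_map,
        MonoidHom.coe_coe, MonoidHom.coe_coe, MonoidHom.coe_coe]
      exact hri ψ' _)

/-- Unfolding `unitsPairHom` on values. [cite: SerreLocalFields1979, Ch. XI §3] -/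
theorem coe_toMul_unitsPairHom (i : L →ₐ[K] L') (r : (L' ≃ₐ[K] L') →* (L ≃ₐ[K] L))
    (hri : ∀ ψ' x, i (r ψ' x) = ψ' (i x)) (x : Additive Lˣ) :
    ((Additive.toMul ((unitsPairHom K i r hri).hom x) : L'ˣ) : L') = i ((Additive.toMul x : Lˣ) : L) := rfl

/-- **The cochain-level inflation `Inf = Hⁿ(r, i) : Hⁿ(Gal(L/K), Lˣ) → Hⁿ(Gal(L'/K), L'ˣ)` of a compatible pair.**
[cite: SerreLocalFields1979, Ch. XI §3] -/
def unitsPairInf (i : L →ₐ[K] L') (r : (L' ≃ₐ[K] L') →* (L ≃ₐ[K] L)) (hri : ∀ ψ' x, i (r ψ' x) = ψ' (i x))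
    (n : ℕ) : groupCohomology (Rep.ofAlgebraAutOnUnits K L) n ⟶ groupCohomology (Rep.ofAlgebraAutOnUnits K L') n :=
  groupCohomology.map r (unitsPairHom K i r hri) n

variable [FiniteDimensional K L]

/-- **Every `K`-embedding of a finite Galois `L` into `K̄` has image `embeddedField K L`** (normality).
[cite: SerreLocalFields1979, Ch. XI §1 (iv)] -/
theorem fieldRange_eq_embeddedField [IsGalois K L] (φ : L →ₐ[K] AlgebraicClosure K) :
    φ.fieldRange = embeddedField K L := by
  have h := AlgHom.fieldRange_of_normal (φ.comp ((embeddedEquiv K L).symm : embeddedField K L →ₐ[K] L))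
  rw [← AlgHom.map_fieldRange, AlgEquiv.fieldRange_eq_top, ← AlgHom.fieldRange_eq_map] at h
  exact h

end Pair

/-! ## §2. `inv ∘ Inf = inv` -/

section Inflation

variable (K : Type) [Field K] [CharZero K]

/-- `unitsInfTwo K L z = infTwo K L (units K) ((unitsLayerH2Iso K L)⁻¹ z)` (unfolding of door-c6's `infTwoOfIso`).
[cite: SerreGaloisCohomology1997, I §2.6] -/
theorem unitsInfTwo_eq_infTwo (L : IntermediateField K (AlgebraicClosure K)) [FiniteDimensional K L] [IsGalois K L]
    (z : groupCohomology (Rep.ofAlgebraAutOnUnits K L) 2) :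
    unitsInfTwo K L z = infTwo K L (units K) ((unitsLayerH2Iso K L).inv z) := rfl

omit [CharZero K] in
/-- `φ (embeddedEquiv⁻¹ z) = z` in `K̄` for the chosen embedding `φ = embeddingToAbs K L`. [cite: SerreLocalFields1979, Ch. XI §1 (iv)] -/
theorem embeddingToAbs_embeddedEquiv_symm {L : Type} [Field L] [Algebra K L] [FiniteDimensional K L]
    (z : embeddedField K L) : embeddingToAbs K L ((embeddedEquiv K L).symm z) = (z : AlgebraicClosure K) := by
  conv_rhs => rw [← (embeddedEquiv K L).apply_symm_apply z]
  rfl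

variable {L L' : Type} [Field L] [Field L'] [Algebra K L] [Algebra K L']
  [FiniteDimensional K L] [IsGalois K L] [FiniteDimensional K L'] [IsGalois K L']
  (i : L →ₐ[K] L') (r : (L' ≃ₐ[K] L') →* (L ≃ₐ[K] L)) (hri : ∀ ψ' x, i (r ψ' x) = ψ' (i x))

omit [FiniteDimensional K L] [IsGalois K L] in
/-- **The square of pair morphisms.**  Let `L₁ ≤ embeddedField K L'` be an embedded layer with an isomorphism
`f₁ : L ≃ₐ[K] L₁` such that `f₁(x) = φ'(i x)` in `K̄` (`φ'` the chosen embedding of `L'`).  Then "`Inf` of the pair,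
transport to the embedded copy of `L'`, back to the layer module `(K̄ˣ)^{Γ}`" equals "transport along `f₁`, back to the
layer module, then door-c6's `layerInf`" — both are `H²` of ONE morphism of pairs `(Γ_K ⧸ Γ_{L₀'}, (K̄ˣ)^{Γ_{L₀'}}) →
(Gal(L/K), Lˣ)`. [cite: SerreGaloisCohomology1997, I §2.2 Prop. 8] -/
theorem unitsPairInf_transport_eq_layerInf (L₁ : IntermediateField K (AlgebraicClosure K)) [FiniteDimensional K L₁]
    [IsGalois K L₁] (h : L₁ ≤ embeddedField K L') (f₁ : L ≃ₐ[K] L₁)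
    (hf₁ : ∀ x : L, ((f₁ x : L₁) : AlgebraicClosure K) = embeddingToAbs K L' (i x)) :
    unitsPairInf K i r hri 2 ≫ (unitsCohomologyIso (embeddedEquiv K L') 2).hom ≫
        (unitsLayerH2Iso K (embeddedField K L')).inv =
      (unitsCohomologyIso f₁ 2).hom ≫ (unitsLayerH2Iso K L₁).inv ≫ layerInf K L₁ (embeddedField K L') (units K) h 2 := by
  have hf₁' : ∀ z : L₁, embeddingToAbs K L' (i (f₁.symm z)) = (z : AlgebraicClosure K) := fun z => by
    rw [← hf₁, f₁.apply_symm_apply]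
  rw [unitsPairInf, unitsCohomologyIso, unitsCohomologyIso, unitsLayerH2Iso, unitsLayerH2Iso, layerInf,
    groupCohomology.mapIso_hom, groupCohomology.mapIso_hom, groupCohomology.mapIso_inv, groupCohomology.mapIso_inv,
    ← groupCohomology.map_comp, ← groupCohomology.map_comp, ← groupCohomology.map_comp, ← groupCohomology.map_comp]
  refine map_congr' ?_ _ _ (fun x => ?_) 2
  · -- the group homomorphisms `Γ_K ⧸ Γ_{L₀'} →* Gal(L/K)` agree: test on `x ∈ L` inside `K̄` through `φ' ∘ i`
    refine MonoidHom.ext fun q => ?_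
    induction q using QuotientGroup.induction_on with
    | H σ =>
      apply AlgEquiv.ext
      intro x
      apply ((embeddingToAbs K L').comp i).injective
      change embeddingToAbs K L' (i (r ((embeddedEquiv K L').autCongr.symm
          (absGaloisQuotientEquiv K (embeddedField K L') (σ : _ ⧸ _))) x)) =
        embeddingToAbs K L' (i ((f₁.autCongr.symm (absGaloisQuotientEquiv K L₁
          (layerQuotientMap K L₁ (embeddedField K L') h (σ : _ ⧸ _)))) x))
      rw [hri, layerQuotientMap_mk]
      simp only [AlgEquiv.autCongr_symm, AlgEquiv.autCongr_apply, AlgEquiv.trans_apply, AlgEquiv.symm_symm]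
      rw [embeddingToAbs_embeddedEquiv_symm, hf₁', coe_absGaloisQuotientEquiv_mk_apply,
        coe_absGaloisQuotientEquiv_mk_apply, hf₁]
      rfl
  · -- the module maps `Lˣ → (K̄ˣ)^{Γ_{L₀'}}` agree: both send `u` to the unit with value `φ'(i u)`
    refine Subtype.ext (UnitsCarrier.toAdditive.injective (Additive.toMul.injective (Units.ext ?_)))
    change (embeddingToAbs K L' (i ((Additive.toMul x : Lˣ) : L)) : AlgebraicClosure K) =
      ((f₁ ((Additive.toMul x : Lˣ) : L) : L₁) : AlgebraicClosure K)
    exact (hf₁ _).symm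

omit [CharZero K] [FiniteDimensional K L] [IsGalois K L] [IsGalois K L'] in
/-- The image of `L` in `K̄` through `L'` lies inside the image of `L'`. [cite: SerreLocalFields1979, Ch. XI §1 (iv)] -/
theorem map_top_comp_le : (⊤ : IntermediateField K L).map ((embeddingToAbs K L').comp i) ≤ embeddedField K L' := by
  rw [← IntermediateField.map_map]
  exact IntermediateField.map_mono _ le_top

/-- **`inv_{L'/K} ∘ Inf = inv_{L/K}` for the cochain-level inflation of a compatible pair** (`K` a non-archimedean local
field of characteristic `0`; Serre XI §2–§3, the class-formation formalism). [cite: SerreLocalFields1979, Ch. XI §2]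
[cite: SerreLocalFields1979, Ch. XI §3] -/
theorem layerInv_unitsPairInf [ValuativeRel K] [TopologicalSpace K] [IsNonarchimedeanLocalField K]
    (x : groupCohomology (Rep.ofAlgebraAutOnUnits K L) 2) :
    layerInv K L' (unitsPairInf K i r hri 2 x) = layerInv K L x := by
  let L₁ : IntermediateField K (AlgebraicClosure K) := (⊤ : IntermediateField K L).map ((embeddingToAbs K L').comp i)
  let f₁ : L ≃ₐ[K] L₁ := IntermediateField.topEquiv.symm.trans (IntermediateField.equivMap ⊤ _)
  haveI : FiniteDimensional K L₁ := LinearEquiv.finiteDimensional f₁.toLinearEquiv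
  haveI : IsGalois K L₁ := IsGalois.of_algEquiv f₁
  have hL : L₁ = embeddedField K L := by
    rw [← fieldRange_eq_embeddedField K ((embeddingToAbs K L').comp i), AlgHom.fieldRange_eq_map]
  have hsq := congrArg (fun φ => φ x)
    (unitsPairInf_transport_eq_layerInf K i r hri L₁ (map_top_comp_le K i) f₁ (fun _ => rfl))
  rw [layerInv_apply, layerInv_apply, unitsInfTwo_unitsCohomologyIso_eq_of_eq K hL f₁ (embeddedEquiv K L) x,
    unitsInfTwo_eq_infTwo, unitsInfTwo_eq_infTwo,
    ← infTwo_layerInf K L₁ (embeddedField K L') (units K) (map_top_comp_le K i)]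
  exact congrArg (brauerInvariantEquiv K) (congrArg (infTwo K (embeddedField K L') (units K)) hsq)

end Inflation

end UnitsLayer

end Literature.NumberTheory.GaloisRepresentations

end
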